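import Summits.Ventures.Crystal3D.Theorems.StickyWulffConstantGenericWallFloorRiserEndRows
import Summits.Ventures.Crystal3D.Theorems.StickyWulffConstantGenericWallFloorExactOnlyTransport
import HarnessLib

/-!
# Riser-end rows: transport under rigid motions and the per-end deficiency reading (crux `GenericWallFloor`,
# stmt-Ventures-19480, line `WallLedgerG`)

HONEST FRAMING. Venture `Summits/Ventures/Crystal3D` (cell `crystal3d-full`), helper `--supports` the crux
`GenericWallFloor` of `route-Ventures-StickyWulffConstant`, REGISTERED line `WallLedgerG`, open stub
`stub_twoSlabAdhesion`.  Pure glue for the obligation format of `…GenericWallFloorRiserEndRows`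
(`ContactsAtMost`, `ContactsAtMostOff`): rows are certified at the ORIGIN in the integer frame, a ledger meets the
pattern at an arbitrary ball `L·0 + t` of an arbitrary grain frame `L`.

* `ContactsAtMost.image`, `ContactsAtMostOff.image` — invariance under rigid motions `x ↦ L x + t`;
* `ContactsAtMost.twelve_sub_le` — the ledger currency: with the row's balls present in a `1`-separated `X`, the
  centre `b` has `12 − k ≤ 12 − #contacts(b)`, i.e. the end PAYS at least `12 − k` missing contacts.

Rung credit only; F-C1 not moved; NO certificate.
-/

noncomputable section

namespace Summit.Ventures.Crystal3D.Theorems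

open Finset Literature.Geometry.DiscreteGeometry

/-- Pulling a configuration back by a rigid motion keeps it `1`-separated. -/
theorem oneSep_image_symm (L : EuclideanSpace ℝ (Fin 3) ≃ₗᵢ[ℝ] EuclideanSpace ℝ (Fin 3)) (t : EuclideanSpace ℝ (Fin 3))
    {X : Finset (EuclideanSpace ℝ (Fin 3))} [DecidableEq (EuclideanSpace ℝ (Fin 3))]
    (hX : ∀ p ∈ X, ∀ q ∈ X, p ≠ q → 1 ≤ dist p q) :
    ∀ p ∈ X.image (fun y => L.symm (y - t)), ∀ q ∈ X.image (fun y => L.symm (y - t)), p ≠ q → 1 ≤ dist p q := by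
  intro p hp q hq hpq
  obtain ⟨x, hx, rfl⟩ := Finset.mem_image.1 hp
  obtain ⟨y, hy, rfl⟩ := Finset.mem_image.1 hq
  have hxy : x ≠ y := fun e => hpq (by rw [e])
  rw [L.symm.dist_map, dist_sub_right]
  exact hX x hx y hy hxy

/-- The contacts of the moved centre correspond to the contacts of the centre (card equality). -/
theorem card_contacts_rigidMotion (L : EuclideanSpace ℝ (Fin 3) ≃ₗᵢ[ℝ] EuclideanSpace ℝ (Fin 3))
    (t b : EuclideanSpace ℝ (Fin 3)) (X : Finset (EuclideanSpace ℝ (Fin 3))) [DecidableEq (EuclideanSpace ℝ (Fin 3))] :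
    (X.filter fun q => dist (L b + t) q = 1).card =
      ((X.image fun y => L.symm (y - t)).filter fun q => dist b q = 1).card := by
  rw [Finset.filter_image, Finset.card_image_of_injective _ ?_]
  · congr 1
    refine Finset.filter_congr fun y _ => ?_
    rw [← dist_rigidMotion L t b (L.symm (y - t)), rigidMotion_symm_apply]
  · intro x y h
    have := congrArg (fun z => L z + t) h
    simpa only [rigidMotion_symm_apply] using this

/-- **`ContactsAtMost` is invariant under rigid motions.** -/
theorem ContactsAtMost.image (L : EuclideanSpace ℝ (Fin 3) ≃ₗᵢ[ℝ] EuclideanSpace ℝ (Fin 3)) (t : EuclideanSpace ℝ (Fin 3))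
    {b : EuclideanSpace ℝ (Fin 3)} {F : Finset (EuclideanSpace ℝ (Fin 3))} {k : ℕ} (h : ContactsAtMost b F k) :
    ContactsAtMost (L b + t) (F.image fun x => L x + t) k := by
  classical
  intro X hX hFX
  rw [card_contacts_rigidMotion]
  refine h _ (oneSep_image_symm L t hX) ?_
  intro f hf
  refine Finset.mem_image.2 ⟨L f + t, hFX (Finset.mem_image_of_mem _ hf), ?_⟩
  exact rigidMotion_symm_apply' L t f

/-- **`ContactsAtMostOff` is invariant under rigid motions.** -/
theorem ContactsAtMostOff.image (L : EuclideanSpace ℝ (Fin 3) ≃ₗᵢ[ℝ] EuclideanSpace ℝ (Fin 3)) (t : EuclideanSpace ℝ (Fin 3))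
    {b : EuclideanSpace ℝ (Fin 3)} {F H : Finset (EuclideanSpace ℝ (Fin 3))} {k : ℕ} (h : ContactsAtMostOff b F H k) :
    ContactsAtMostOff (L b + t) (F.image fun x => L x + t) (H.image fun x => L x + t) k := by
  classical
  intro X hX hFX hHX
  rw [card_contacts_rigidMotion]
  refine h _ (oneSep_image_symm L t hX) ?_ ?_
  · intro f hf
    refine Finset.mem_image.2 ⟨L f + t, hFX (Finset.mem_image_of_mem _ hf), ?_⟩
    exact rigidMotion_symm_apply' L t f
  · intro s hs hsX
    obtain ⟨y, hy, hys⟩ := Finset.mem_image.1 hsX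
    have : y = L s + t := by rw [← rigidMotion_symm_apply L t y, hys]
    exact hHX (L s + t) (Finset.mem_image_of_mem _ hs) (this ▸ hy)

/-- **The ledger currency of a row**: if `ContactsAtMost b F k` holds and the row's balls are present in a
`1`-separated `X`, then the centre has at most `k` contacts, i.e. it PAYS at least `12 − k` missing contacts
(stated as `12 - k ≤ 12 - #contacts`, natural subtraction; with `k ≤ 12` this is the deficiency lower bound). -/
theorem ContactsAtMost.twelve_sub_le {b : EuclideanSpace ℝ (Fin 3)} {F : Finset (EuclideanSpace ℝ (Fin 3))} {k : ℕ}
    (h : ContactsAtMost b F k) {X : Finset (EuclideanSpace ℝ (Fin 3))} [DecidableEq (EuclideanSpace ℝ (Fin 3))]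
    (hX : ∀ p ∈ X, ∀ q ∈ X, p ≠ q → 1 ≤ dist p q) (hFX : F ⊆ X) :
    12 - k ≤ 12 - (X.filter fun q => dist b q = 1).card := by
  have := h X hX hFX
  omega

end Summit.Ventures.Crystal3D.Theorems

end
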